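import Summits.HodgeConjecture.HodgeConjecture.Theorems.MarkmanPartnerTransportPicardThreeK3SquaresOneCycleDegreeHodge
import Summits.HodgeConjecture.HodgeConjecture.Theorems.MarkmanPartnerTransportPicardThreeK3SquaresSectorIff
import Summits.HodgeConjecture.HodgeConjecture.Theorems.MarkmanPartnerTransportK3Sq2TypeHodgeOfPicardThree

/-!
# Route MarkmanPartnerTransport · crux `PicardThreeK3Squares` (stmt-HodgeConjecture-19652) —
# ONE CYCLE SUFFICES, part 9: the crux BY NAME, and the route's target at `ρ(X) ≥ 4`, from the
# «one algebraic self-correspondence per RM K3 surface» clause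

The crux `PicardThreeK3Squares` (HC⁴(S ⊗ S) for every marked projective K3 surface `S` with
`ρ(S) ≥ 3`) was reduced by gen 0 to the cycle-induced sector clause on non-CM, non-scalar K3 surfaces
with `3 ≤ ρ(S) ≤ 16` (`HighPicard.picardThreeK3Squares_of_realMultiplicationThird_le_sixteen`, modulo
Buskin's Thm. 1.1 and markings). The line «one cycle suffices» (parts 1–8) replaces that clause — ALL of
`End_Hdg T(S)` cycle-induced — by ONE endomorphism per surface:

* `picardThreeK3Squares_of_oneCycleThird` — **`PicardThreeK3Squares` BY NAME, granted Buskin's Thm. 1.1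
  and markings, from: every projective K3 surface `S` with `3 ≤ ρ(S) ≤ 16`, not of CM type and with
  `End_Hdg T(S) ≠ ℚ`, carries ONE endomorphism of `H²(S(ℂ); ℂ)` preserving rational classes and Hodge
  types, induced by an algebraic class on `S × S`, whose eigenvalue `ev` on the `2`-form has minimal
  polynomial of a degree `k` with `k · j · m + ρ(S) ≠ 22` for all `j ≥ 2`, `m ≥ 3`** (at
  `ρ(S) ∈ {7, 8, 12, 13, 14, 16}` every non-rational `ev` qualifies — `prime_of_mul_add_eq`; at `ρ = 10`
  degree `≥ 3`, at `ρ = 6` degree `4`, at `ρ = 4` degree `≥ 4`);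
* `picardThreeK3Squares_of_oneCycle_of_generation` — the same with the clause split: a non-rational
  eigenvalue at `ρ(S) ∉ {4, 6, 10}`, the generation clause `TranscendentalEndomorphismsGeneratedBy` at
  `ρ(S) ∈ {4, 6, 10}`;
* `hodgeConjectureFor_of_oneCycleThird_of_four_le` — **the route's TARGET `K3Sq2TypeHodge` at `ρ(X) ≥ 4`**
  (every marked smooth projective `K3^{[2]}`-type fourfold with `ρ(X) ≥ 4`) from the same one-cycle clause,
  modulo the seven named facts of `PartnerLattice.hodgeConjectureFor_of_picardThreeK3Squares_of_four_le`
  (period surjectivity, Beauville's marked incidence and blow-up, Markman's lift, Voisin's cup product,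
  Buskin, markings).

So the open content of the crux is, by name: «one algebraic self-correspondence with an eigenvalue of
admissible degree on every non-CM RM K3 surface with 3 ≤ ρ ≤ 16» — the printed shape of van Geemen–
Schütt's constructions (§4.8, §6.4), required now for EVERY member of each RM component rather than the
very general one. CONDITIONAL; credits nothing. No definition, no sorry. Prover seat hodge-nonav-19652-p1
(gen 8), `--supports stmt-HodgeConjecture-19652`.

References: van Geemen–Schütt, Forum Math. Sigma 13 (2025) e2, §4.8, Rem. 4.9, §6.4; van Geemen,
Michigan Math. J. 56 (2008), Lemma 3.2; Varesco, Math. Z. 305 (2023), §2; Buskin, J. reine angew. Math.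
755 (2019), Thm. 1.1; Markman, Compos. Math. 160 (2024), Thm. 1.1; Beauville, J. Differential Geom. 18
(1983), §6–9.
-/

set_option linter.dupNamespace false

noncomputable section

namespace Summit.HodgeConjecture.HodgeConjecture.Theorems.MarkmanPartnerTransport.OneCycle

open scoped Manifold TensorProduct
open Module CategoryTheory MonoidalCategory CartesianMonoidalCategory Polynomial
open Literature.AlgebraicGeometry Literature.AlgebraicGeometry.Motives Literature.AlgebraicGeometry.HodgeTheory
open Literature.AlgebraicGeometry.Hyperkaehler Literature.AlgebraicGeometry.HilbertScheme
open Literature.AlgebraicGeometry.Surfaces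
open Literature.AlgebraicTopology.SingularHomology
open Summit.HodgeConjecture.HodgeConjecture.Theorems
open Summit.HodgeConjecture.HodgeConjecture.Theorems.NikulinTwinTransport
open Summit.HodgeConjecture.HodgeConjecture.Theses.MarkmanPartnerTransport

/-- `Corr[μ, hS ; γ, y] = pr₁_*(pr₂^* y ∪ γ)` on `H²(S(ℂ); ℂ)`. Local notation only. -/
local notation3 (prettyPrint := false) "Corr[" μ ", " hS " ; " γ ", " y "]" =>
  complexGysin μ (IsSmoothProjective.tensor_holds hS hS) hS
    (SemiCartesianMonoidalCategory.fst _ _) (rfl : 2 * 1 + 2 * 2 + 2 * 2 = 2 * 1 + 2 * (2 + 2))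
    (cupProduct (rfl : 2 * 1 + 2 * 2 = 2 * 1 + 2 * 2)
      (complexBetti.map (SemiCartesianMonoidalCategory.snd _ _) (2 * 1) y) γ)

/-- `MarkedK3Sq[X, φ, P, z]`: VERBATIM the `let MarkedK3Sq := …` binder of the route declarations of
MarkmanPartnerTransport (clauses (m1)–(m6)). Local notation only. -/
local notation3 (prettyPrint := false) "MarkedK3Sq[" X ", " φ ", " P ", " z "]" =>
  (((IsIntegralClass P ∧ ∀ Q : complexBetti X (2 * 4), IsIntegralClass Q → ∃ n : ℤ, Q = n • P) ∧
    (∀ c : complexBetti X 2, IsIntegralClass c ↔ ∃ v : K3HilbertIndex → ℤ, φ c = fun i => (v i : ℂ)) ∧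
    (∀ a : complexBetti X 2, cupPowTwo a 4 = ((3 : ℂ) * (k3HilbertForm 2 (φ a) (φ a)) ^ 2) • P) ∧
    (IsOfHodgeType 4 X 2 2 0 (LinearEquiv.symm φ z) ∧
      ∀ τ : complexBetti X 2, IsOfHodgeType 4 X 2 2 0 τ → ∃ t : ℂ, τ = t • LinearEquiv.symm φ z) ∧
    (∀ c : complexBetti X 2, IsOfHodgeType 4 X 2 1 1 c ↔
      (k3HilbertForm 2 (φ c) z = 0 ∧ k3HilbertForm 2 (φ c) (star z) = 0)) ∧
    (k3HilbertForm 2 z z = 0 ∧ 0 < (k3HilbertForm 2 (star z) z).re)))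

/-- `Scalar[S]`: «`End_Hdg T(S) = ℚ`» — every rational Hodge endomorphism of `H²(S(ℂ); ℂ)` killing `N¹`
with image `⊥ N¹` is a rational scalar on `T` (VERBATIM the clause of `HighPicard`). Local notation only. -/
local notation3 (prettyPrint := false) "Scalar[" S "]" =>
  (∀ (f : complexBetti S (2 * 1) →ₗ[ℂ] complexBetti S (2 * 1)),
    (∀ y, IsRationalClass y → IsRationalClass (f y)) →
    (∀ (i j : ℕ) y, IsOfHodgeType 2 S (2 * 1) i j y → IsOfHodgeType 2 S (2 * 1) i j (f y)) →
    (∀ d ∈ algebraicClasses S 1, f d = 0) →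
    (∀ y : complexBetti S (2 * 1), ∀ d ∈ algebraicClasses S 1,
      cupProduct (rfl : 2 * 1 + 2 * 1 = 2 * 2) (f y) d = 0) →
    ∃ a : ℚ, ∀ y : complexBetti S (2 * 1),
      (∀ d ∈ algebraicClasses S 1, cupProduct (rfl : 2 * 1 + 2 * 1 = 2 * 2) y d = 0) →
        f y = (a : ℂ) • y)

/-- `OneCycleOfDegree[S, hS]`: «`S` carries ONE endomorphism of `H²(S(ℂ); ℂ)` preserving rational classes
and Hodge types, induced by an algebraic class on `S × S` (complex orientations), with an eigenvalue
`ev` on a non-zero `(2,0)`-class whose minimal polynomial has a degree `k` such that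
`k · j · m + ρ(S) ≠ 22` for all `j ≥ 2`, `m ≥ 3`». Local notation only. -/
local notation3 (prettyPrint := false) "OneCycleOfDegree[" S ", " hS "]" =>
  (∃ (k : ℕ) (e : complexBetti S (2 * 1) →ₗ[ℂ] complexBetti S (2 * 1)),
    (∀ j m : ℕ, 2 ≤ j → 3 ≤ m → k * j * m + Module.finrank ℂ ↥(algebraicClasses S 1) ≠ 22) ∧
    (∀ y, IsRationalClass y → IsRationalClass (e y)) ∧
    (∀ (i j : ℕ) y, IsOfHodgeType 2 S (2 * 1) i j y → IsOfHodgeType 2 S (2 * 1) i j (e y)) ∧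
    (∃ γ ∈ algebraicClasses (S ⊗ S) 2, ∀ y : complexBetti S (2 * 1),
      e y = Corr[complexOrientationFamily, IsK3Surface.isSmoothProjective hS ; γ, y]) ∧
    (∃ (σ₀ : complexBetti S (2 * 1)) (ev : ℂ), IsOfHodgeType 2 S (2 * 1) 2 0 σ₀ ∧ σ₀ ≠ 0 ∧
      e σ₀ = ev • σ₀ ∧ (minpoly ℚ ev).natDegree = k))

/-! ### The crux by name from the one-cycle clause -/

/-- **`PicardThreeK3Squares` BY NAME from «one cycle of admissible degree on every non-CM RM K3 surface
with `3 ≤ ρ ≤ 16`», granted Buskin's Thm. 1.1 and markings.** The one-cycle clause gives HC⁴(S ⊗ S)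
(`hodgeConjectureFor_square_of_oneCycle_natDegree`), hence the cycle-induced sector clause
(`SectorIff.cycleInducedSector_of_hodgeConjectureFor_square`), which is the hypothesis of
`HighPicard.picardThreeK3Squares_of_realMultiplicationThird_le_sixteen`.
[cite: GeemenSchutt2023, §4.8, Rem. 4.9 and §6.4] [cite: Vangeemen2008, Lemma 3.2] [cite: Varesco2023, §2 (p. 8)]
[cite: Buskin2019, Thm. 1.1] -/
theorem picardThreeK3Squares_of_oneCycleThird (hB : Buskin2019_hodgeIsometry_algebraic)
    (hmark : Huybrechts_K3_marking_exists)
    (hOne : ∀ (S : SchemeOver ℂ) (hS : IsK3Surface S), ¬ HasComplexMultiplication S →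
      3 ≤ Module.finrank ℂ ↥(algebraicClasses S 1) → Module.finrank ℂ ↥(algebraicClasses S 1) ≤ 16 →
      ¬ Scalar[S] → OneCycleOfDegree[S, hS]) :
    PicardThreeK3Squares :=
  HighPicard.picardThreeK3Squares_of_realMultiplicationThird_le_sixteen hB hmark
    fun S hS hCM h3 h16 hQ ↦ by
      obtain ⟨k, e, hk, hrat, htyp, hcyc, hev⟩ := hOne S hS hCM h3 h16 hQ
      exact SectorIff.cycleInducedSector_of_hodgeConjectureFor_square complexOrientationFamily
        hS.isSmoothProjective
        (hodgeConjectureFor_square_of_oneCycle_natDegree hmark hS hk hCM complexOrientationFamily e hrat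
          htyp hcyc hev)

/-- **`PicardThreeK3Squares` BY NAME from the split clause**: at `ρ(S) ∉ {4, 6, 10}` one cycle-induced
rational Hodge endomorphism with a NON-RATIONAL eigenvalue on the `2`-form
(`hodgeConjectureFor_square_of_oneCycle` + `prime_of_mul_add_eq`); at `ρ(S) ∈ {4, 6, 10}` a cycle-induced
one GENERATING `End_Hdg T(S)` (`hodgeConjectureFor_square_of_generatedBy_of_mapsTo`). Granted Buskin's
Thm. 1.1 and markings. [cite: GeemenSchutt2023, §4.8 and Rem. 4.9] [cite: Vangeemen2008, Lemma 3.2]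
[cite: Varesco2023, §2 (p. 8)] [cite: Buskin2019, Thm. 1.1] -/
theorem picardThreeK3Squares_of_oneCycle_of_generation (hB : Buskin2019_hodgeIsometry_algebraic)
    (hmark : Huybrechts_K3_marking_exists)
    (hOne : ∀ (S : SchemeOver ℂ) (hS : IsK3Surface S), ¬ HasComplexMultiplication S →
      3 ≤ Module.finrank ℂ ↥(algebraicClasses S 1) → Module.finrank ℂ ↥(algebraicClasses S 1) ≤ 16 →
      Module.finrank ℂ ↥(algebraicClasses S 1) ≠ 4 → Module.finrank ℂ ↥(algebraicClasses S 1) ≠ 6 →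
      Module.finrank ℂ ↥(algebraicClasses S 1) ≠ 10 → ¬ Scalar[S] →
      ∃ e : complexBetti S (2 * 1) →ₗ[ℂ] complexBetti S (2 * 1),
        (∀ y, IsRationalClass y → IsRationalClass (e y)) ∧
        (∀ (i j : ℕ) y, IsOfHodgeType 2 S (2 * 1) i j y → IsOfHodgeType 2 S (2 * 1) i j (e y)) ∧
        (∃ γ ∈ algebraicClasses (S ⊗ S) 2, ∀ y : complexBetti S (2 * 1),
          e y = Corr[complexOrientationFamily, IsK3Surface.isSmoothProjective hS ; γ, y]) ∧
        (∃ (σ₀ : complexBetti S (2 * 1)) (ev : ℂ), IsOfHodgeType 2 S (2 * 1) 2 0 σ₀ ∧ σ₀ ≠ 0 ∧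
          e σ₀ = ev • σ₀ ∧ ∀ a : ℚ, (a : ℂ) ≠ ev))
    (hGen : ∀ (S : SchemeOver ℂ) (hS : IsK3Surface S), ¬ HasComplexMultiplication S →
      (Module.finrank ℂ ↥(algebraicClasses S 1) = 4 ∨ Module.finrank ℂ ↥(algebraicClasses S 1) = 6 ∨
        Module.finrank ℂ ↥(algebraicClasses S 1) = 10) → ¬ Scalar[S] →
      ∃ e : complexBetti S (2 * 1) →ₗ[ℂ] complexBetti S (2 * 1),
        (∀ y, IsRationalClass y → IsRationalClass (e y)) ∧
        (∀ (i j : ℕ) y, IsOfHodgeType 2 S (2 * 1) i j y → IsOfHodgeType 2 S (2 * 1) i j (e y)) ∧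
        (∃ γ ∈ algebraicClasses (S ⊗ S) 2, ∀ y : complexBetti S (2 * 1),
          e y = Corr[complexOrientationFamily, IsK3Surface.isSmoothProjective hS ; γ, y]) ∧
        TranscendentalEndomorphismsGeneratedBy S e) :
    PicardThreeK3Squares := by
  refine HighPicard.picardThreeK3Squares_of_realMultiplicationThird_le_sixteen hB hmark
    fun S hS hCM h3 h16 hQ ↦ SectorIff.cycleInducedSector_of_hodgeConjectureFor_square
      complexOrientationFamily hS.isSmoothProjective ?_
  by_cases h4610 : Module.finrank ℂ ↥(algebraicClasses S 1) = 4 ∨ Module.finrank ℂ ↥(algebraicClasses S 1) = 6 ∨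
      Module.finrank ℂ ↥(algebraicClasses S 1) = 10
  · obtain ⟨e, hrat, htyp, hcyc, hgen⟩ := hGen S hS hCM h4610 hQ
    exact hodgeConjectureFor_square_of_generatedBy_of_mapsTo complexOrientationFamily hS.isSmoothProjective e
      (mapsTo_algebraicClasses_one hS.isSmoothProjective e hrat htyp) hcyc hgen
  · push Not at h4610
    obtain ⟨h4, h6, h10⟩ := h4610
    have h2 : Module.finrank ℂ ↥(algebraicClasses S 1) ≠ 2 := by omega
    obtain ⟨e, hrat, htyp, hcyc, hev⟩ := hOne S hS hCM h3 h16 h4 h6 h10 hQ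
    exact hodgeConjectureFor_square_of_oneCycle hmark hS (fun _ _ hd hm h ↦ prime_of_mul_add_eq h2 h4 h6 h10 hd hm h)
      hCM complexOrientationFamily e hrat htyp hcyc hev

/-! ### The route's target at `ρ(X) ≥ 4` -/

/-- **`K3Sq2TypeHodge` at `ρ(X) ≥ 4` from the one-cycle clause**: every marked smooth projective
`K3^{[2]}`-type fourfold `X` with `ρ(X) ≥ 4` satisfies `HodgeConjectureFor 4 X`, granted the seven named
facts of `PartnerLattice.hodgeConjectureFor_of_picardThreeK3Squares_of_four_le` and the one-cycle clause
of `picardThreeK3Squares_of_oneCycleThird` (partner `S` with `ρ(S) = ρ(X) − 1 ≥ 3`; Markman transport).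
CONDITIONAL; credits nothing. [cite: Markman2024, §1.1 Thm. 1.1] [cite: Beauville1983, §6]
[cite: GeemenSchutt2023, §4.8 and Rem. 4.9] [cite: Buskin2019, Thm. 1.1] -/
theorem hodgeConjectureFor_of_oneCycleThird_of_four_le (hP : Huybrechts_K3_periodSurjective_projective)
    (hBI : Beauville1983_hilbertSquare_markedIncidence)
    (hρ : Beauville1983_hilbertSquare_blowupDiagonal_surjection)
    (hMk : Markman2024_rationalHodgeIsometry_lift_algebraic_marked)
    (hcup : Voisin2003_cupProduct_algebraicClasses) (hB : Buskin2019_hodgeIsometry_algebraic)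
    (hmark : Huybrechts_K3_marking_exists)
    (hOne : ∀ (S : SchemeOver ℂ) (hS : IsK3Surface S), ¬ HasComplexMultiplication S →
      3 ≤ Module.finrank ℂ ↥(algebraicClasses S 1) → Module.finrank ℂ ↥(algebraicClasses S 1) ≤ 16 →
      ¬ Scalar[S] → OneCycleOfDegree[S, hS])
    {X : SchemeOver ℂ} (hX : IsSmoothProjective 4 X) (hK : IsOfK3HilbertSquareType X)
    {φ : complexBetti X 2 ≃ₗ[ℂ] (K3HilbertIndex → ℂ)} {P : complexBetti X (2 * 4)} {z : K3HilbertIndex → ℂ}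
    (hM : MarkedK3Sq[X, φ, P, z]) (h4 : 4 ≤ Module.finrank ℂ (algebraicClasses X 1)) :
    HodgeConjectureFor 4 X :=
  PartnerLattice.hodgeConjectureFor_of_picardThreeK3Squares_of_four_le hP hBI hρ hMk hcup
    (picardThreeK3Squares_of_oneCycleThird hB hmark hOne) hX hK hM h4

end Summit.HodgeConjecture.HodgeConjecture.Theorems.MarkmanPartnerTransport.OneCycle

end
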